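import Summits.CriticalPhenomena.SAWScalingLimit.Theorems.SAWRenewalTightnessSubseqIdentificationSleAvoidProduct
import Summits.CriticalPhenomena.SAWScalingLimit.Theorems.SAWRenewalTightnessSubseqIdentificationThm65TiltedAssembly
import Summits.CriticalPhenomena.SAWScalingLimit.Theorems.SAWRenewalTightnessSubseqIdentificationTiltedMartingalesAssembly
import Summits.CriticalPhenomena.SAWScalingLimit.Theorems.SAWRenewalTightnessSubseqIdentificationTiltedProductMartingale
import Summits.CriticalPhenomena.SAWScalingLimit.Theorems.SAWRenewalTightnessSubseqIdentificationTiltedBracketMartingale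
import HarnessLib

/-!
# The tilted [LSW] Theorem 6.5 at law level (line `boundary-area-law`, RS5 part L1)

Line `boundary-area-law` of the crux `SubseqIdentification` (stmt-CriticalPhenomena-0783, route
`SAWRenewalTightness`; primary decl `SAWParafermion.SubseqIdentification`), restriction reshape
(lead c4, r-c4-7): the SLE-side rigidity RS5 is derived by the landed glue
`stub_sleRestrictionRigidityBelow_of_lawParts` from three law-level parts; this file is part (L1),
`stub_tiltedLawIdentity`, THE TILTED THEOREM 6.5 AT LAW LEVEL.

Setting: `0 < κ ≤ 8/3`, `(D; a, b)` a Dobrushin domain with a flat window at `x₀`,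
`D' = D ∖ B̄(x₀, r)` the carved domain (same marked points; a hull subdomain,
`isHullSubdomain_of_carved`), `φ` a chordal uniformizing map of `D`, `Γ` the SLE_κ curve of `D`
through `φ` (a.s. the class of the compactified image of the trace `γ = sleTrace κ ω` under `φ`),
`A = cl(ℍ ∖ φ⁻¹ D') ∈ 𝒬*` the pulled-back hull (`IsStarHull.pullbackHull`), `Φ = Φ_A` its
restriction map with `Φ'(0) = d`, `E_A = {γ ∩ A = ∅}`, and
`X_A = 𝒫(λ_κ ∫₀^∞ m(A_t − W_t) dt)` the compensator weight (`𝒫(x) = e^{−x}`,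
`m = starBubbleMass`, `λ_κ = sleBubbleIntensity κ`), `μ' = SLE_κ(D')`.

* `thm65Tilted_proved` — the PROVED avoidance form of the tilted Theorem 6.5,
  `E[1{γ ∩ A = ∅, Φ_A(γ(0,∞)) ∩ B = ∅} X_A] = d^α P[γ ∩ B = ∅]` for `A, B ∈ 𝒬*`
  (`stub_thm65Tilted_of_tiltedMartingales` ∘ `stub_tiltedMartingales_of_products` ∘
  (`stub_tiltedProductMartingale`, `stub_tiltedBracketMartingale`), all landed).
* `thm65Tilted_anchored` — the same identity with `B` replaced by an ANCHORED TEST SET `S`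
  (closed, bounded, `0 ∉ S`, `S ∪ {Im ≤ 0}` connected, or `S = ∅`): both events only see the
  fill `hpFill S ∈ 𝒬*` (`disjoint_range_hpFill_iff`, `IsRestrictionMap.forall_notMem_hpFill`),
  and both are null when `0 ∈ hpFill S`.
* `stub_tiltedLawIdentity` (registered, L1) — `∫_{E_A ∩ Γ⁻¹ T} X_A dP = d^α · μ'(T)` for every
  Borel `T`: the finite measure `ν₁ = (1_{E_A} X_A · P) ∘ Γ⁻¹` equals `d^α · μ'`.

**Proof of L1** (the tilted twin of `IsSLELaw.hullRestriction_eightThirds_of_facts`,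
`HullRestrictionSLE`). Let `ψ = φ ∘ Φ_A⁻¹`, a chordal uniformizing map of `D'`
(`IsChordalUniformizing.pullback`); by uniqueness in law `μ' = P ∘ Γ'⁻¹` with `Γ'` the SLE curve
of `D'` through `ψ` (`exists_isSLECurve_through_of_ae_tendsto`, `IsSLECurve.map_eq_holds`). Both
`ν₁` and `d^α μ'` are finite measures carried by the chordal carrier of `D'` (Rohde–Schramm
simplicity for `κ ≤ 4`, `IsSLELaw.ae_simple`/`ae_endpoints`; on `E_A` the image trace lies in
`D' ∪ {a, b}`, `disjoint_range_pullbackHull_iff`), so by the transfer theorem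
`CurveClass.Measure.ext_of_missCode_injOn` (Lusin–Souslin; the curve-space form of [LSW]
Lemma 3.2) and the injectivity of the avoidance code of the image test sets `ψ̂(S)`
(`injOn_missCode_imageTest`) it suffices to check the sets `T_S = {c | c ∩ ψ̂(S) = ∅}` for the
anchored rational test sets `S`. There `μ'(T_S) = P[γ ∩ S = ∅]`
(`IsCompactifiedImage.mk_mem_rangeSubset_compl_image_iff`) and, on `E_A`,
`Γ ∈ T_S ↔ Φ_A(γ(0,∞)) ∩ S = ∅` (`mk_mem_rangeSubset_compl_image_iff_of_disjoint`), so
`ν₁(T_S) = E[1{E_A, Φ_A(γ) ∩ S = ∅} X_A] = d^α P[γ ∩ S = ∅]` by `thm65Tilted_anchored`.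
No measurability of `X_A` is needed (`withDensity` of the raw weight on a Borel version of `E_A`,
`nullMeasurableSet_setOf_disjoint`).

References: G. F. Lawler, O. Schramm, W. Werner, *Conformal restriction: the chordal case*,
J. Amer. Math. Soc. 16 (2003), Thm. 6.5, Prop. 5.3, Lemma 3.2 with Lemma 2.1; S. Rohde,
O. Schramm, *Basic properties of SLE*, Ann. of Math. 161 (2005), Thm. 6.1. No named fact is used.
-/

noncomputable section

open MeasureTheory Filter Topology Set Metric Function
open scoped NNReal ENNReal
open Literature.Probability.RandomPlanarGeometry
open Literature.Probability.Process (preWienerMeasure)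
open UpperHalfPlane (upperHalfPlaneSet)

namespace Summit.CriticalPhenomena.SAWScalingLimit.Theorems.SubseqIdentification.BoundaryAreaLaw

/-! ### The proved tilted Theorem 6.5, and its extension to anchored test sets -/

/-- **The tilted [LSW] Theorem 6.5 (avoidance form), PROVED**: for `0 < κ ≤ 8/3`, `A, B ∈ 𝒬*`,
`Φ = Φ_A` with `Φ'(0) = d`, `E[1{γ ∩ A = ∅, ∀ t > 0, Φ(γ t) ∉ B} X_A] = d^α · P[γ ∩ B = ∅]`. This is
the registered statement `stub_thm65Tilted` of the line skeleton, assembled from the landed pieces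
`stub_thm65Tilted_of_tiltedMartingales`, `stub_tiltedMartingales_of_products`,
`stub_tiltedProductMartingale`, `stub_tiltedBracketMartingale`.
[cite: LawlerSchrammWerner2003Restriction, Thm. 6.5 with Prop. 5.3 and §5 (5.1)–(5.3)] -/
theorem thm65Tilted_proved :
    ∀ (κ : ℝ≥0), 0 < κ → κ ≤ 8 / 3 → ∀ (A B : Set ℂ), IsStarHull A → IsStarHull B →
      ∀ (Φ : ConformalEquiv (upperHalfPlaneSet \ A) upperHalfPlaneSet), IsRestrictionMap A Φ →
        ∀ (d : ℝ), HasRestrictionDeriv A Φ d →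
          ∫⁻ ω, {ω | Disjoint (range (sleTrace κ ω)) A ∧ ∀ t, 0 < t → Φ (sleTrace κ ω t) ∉ B}.indicator
              (fun ω => poissonAvoidance (sleBubbleIntensity κ *
                ∫⁻ t, ENNReal.ofReal (starBubbleMass (Loewner.slidHull (sleDriving κ ω) A t)) ∂timeMeasure)) ω
            ∂preWienerMeasure =
          ENNReal.ofReal (d ^ sleBubbleExponent κ) * preWienerMeasure {ω | Disjoint (range (sleTrace κ ω)) B} :=
  stub_thm65Tilted_of_tiltedMartingales
    (stub_tiltedMartingales_of_products stub_tiltedProductMartingale stub_tiltedBracketMartingale)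

/-- **The tilted Theorem 6.5 tested on anchored sets.** For `0 < κ ≤ 8/3`, `A ∈ 𝒬*` with
restriction data `(Φ, d)`, and a closed bounded `S ∌ 0` which is empty or has `S ∪ {Im ≤ 0}`
connected: `E[1{γ ∩ A = ∅, ∀ t > 0, Φ(γ t) ∉ S} X_A] = d^α · P[γ ∩ S = ∅]`. If `0 ∈ Fill(S)` both
sides vanish (a transient path from `0` avoiding `S` keeps `0` outside the fill,
`zero_notMem_hpFill_of_disjoint`, `IsRestrictionMap.forall_notMem_hpFill`); otherwise
`Fill(S) ∈ 𝒬*` (`isStarHull_hpFill`), both events are unchanged when `S` is replaced by its fill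
(`disjoint_range_hpFill_iff`), and `thm65Tilted_proved` applies. (Transience of the trace is the
hypothesis `htr`, supplied by any SLE curve description, `IsSLECurve.ae_tendsto_norm_sleTrace_atTop`.)
[cite: LawlerSchrammWerner2003Restriction, Thm. 6.5 with Lemma 2.1 (p. 8)] -/
theorem thm65Tilted_anchored {κ : ℝ≥0} (hκ0 : 0 < κ) (hκ : κ ≤ 8 / 3) {A : Set ℂ} (hA : IsStarHull A)
    {Φ : ConformalEquiv (upperHalfPlaneSet \ A) upperHalfPlaneSet} (hΦ : IsRestrictionMap A Φ) {d : ℝ}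
    (hd : HasRestrictionDeriv A Φ d)
    (htr : ∀ᵐ ω ∂preWienerMeasure, Tendsto (fun t ↦ ‖sleTrace κ ω t‖) atTop atTop)
    {S : Set ℂ} (hSc : IsClosed S) (hSb : Bornology.IsBounded S) (h0S : (0 : ℂ) ∉ S)
    (hS : S = ∅ ∨ IsConnected (S ∪ {z : ℂ | z.im ≤ 0})) :
    ∫⁻ ω, {ω | Disjoint (range (sleTrace κ ω)) A ∧ ∀ t, 0 < t → Φ (sleTrace κ ω t) ∉ S}.indicator
        (fun ω => poissonAvoidance (sleBubbleIntensity κ *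
          ∫⁻ t, ENNReal.ofReal (starBubbleMass (Loewner.slidHull (sleDriving κ ω) A t)) ∂timeMeasure)) ω
      ∂preWienerMeasure =
    ENNReal.ofReal (d ^ sleBubbleExponent κ) * preWienerMeasure {ω | Disjoint (range (sleTrace κ ω)) S} := by
  rcases hS with rfl | hanch
  · exact thm65Tilted_proved κ hκ0 hκ A ∅ hA isStarHull_empty Φ hΦ d hd
  have hκ4 : κ ≤ 4 := le_four_of_le_eightThirds hκ
  have hFa : isSimplyConnected_of_isConnected_compl := isSimplyConnected_of_isConnected_compl_holds
  have hAc : IsClosed A := hA.isBoundedHull.isClosed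
  have hgen : HasSLETrace κ := hasSLETrace_of_ne_eight_holds (ne_eight_of_le_eightThirds hκ)
  have hgood : ∀ᵐ ω ∂preWienerMeasure, Loewner.IsGeneratedByCurve (sleDriving κ ω) (sleTrace κ ω) ∧
      Loewner.IsSimpleTrace (sleTrace κ ω) ∧ Tendsto (fun t ↦ ‖sleTrace κ ω t‖) atTop atTop := by
    filter_upwards [ae_isGeneratedByCurve_sleTrace hgen, ae_isSimpleTrace_sleTrace_of_hasSLETrace hgen hκ4,
      htr] with ω h₁ h₂ h₃
    exact ⟨h₁, h₂, h₃⟩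
  by_cases h0F : (0 : ℂ) ∈ hpFill S
  · -- `0` is enclosed by `S`: both events are null
    have hL0 : preWienerMeasure {ω | Disjoint (range (sleTrace κ ω)) S} = 0 := by
      refine measure_eq_zero_iff_ae_notMem.2 ?_
      filter_upwards [hgood] with ω ⟨hg, hsimple, htr'⟩ hdisj
      exact zero_notMem_hpFill_of_disjoint hSc hg.continuous (sleTrace_zero _ ω) hsimple.2 htr' hdisj h0F
    have hR0 : (fun ω ↦ {ω | Disjoint (range (sleTrace κ ω)) A ∧ ∀ t, 0 < t → Φ (sleTrace κ ω t) ∉ S}.indicator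
        (fun ω => poissonAvoidance (sleBubbleIntensity κ *
          ∫⁻ t, ENNReal.ofReal (starBubbleMass (Loewner.slidHull (sleDriving κ ω) A t)) ∂timeMeasure)) ω)
        =ᵐ[preWienerMeasure] fun _ ↦ 0 := by
      filter_upwards [hgood] with ω ⟨hg, hsimple, htr'⟩
      refine indicator_of_notMem (fun hω ↦ ?_) _
      exact (hΦ.forall_notMem_hpFill hAc hg.continuous (sleTrace_zero _ ω) hsimple.2 htr' hω.1 hSc hSb
        h0S hω.2).1 h0F
    rw [hL0, mul_zero, lintegral_congr_ae hR0, lintegral_zero]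
  · -- the fill of `S` is a `*`-hull
    have hB : IsStarHull (hpFill S) := isStarHull_hpFill hFa hSc hSb hanch h0F
    have hL1 : preWienerMeasure {ω | Disjoint (range (sleTrace κ ω)) S} =
        preWienerMeasure {ω | Disjoint (range (sleTrace κ ω)) (hpFill S)} := by
      refine measure_congr (eventuallyEq_set.2 ?_)
      filter_upwards [hgood] with ω ⟨hg, hsimple, htr'⟩
      exact (disjoint_range_hpFill_iff hSc hSb h0S hg.continuous (sleTrace_zero _ ω) hsimple.2 htr').symm
    have hR1 : ({ω | Disjoint (range (sleTrace κ ω)) A ∧ ∀ t, 0 < t → Φ (sleTrace κ ω t) ∉ S} :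
        Set (ℝ≥0 → ℝ)) =ᵐ[preWienerMeasure]
        ({ω | Disjoint (range (sleTrace κ ω)) A ∧ ∀ t, 0 < t → Φ (sleTrace κ ω t) ∉ hpFill S} :
          Set (ℝ≥0 → ℝ)) := by
      refine eventuallyEq_set.2 ?_
      filter_upwards [hgood] with ω ⟨hg, hsimple, htr'⟩
      refine and_congr_right fun hE ↦ ⟨fun hav ↦ ?_, fun hav t ht hS' ↦ ?_⟩
      · exact (hΦ.forall_notMem_hpFill hAc hg.continuous (sleTrace_zero _ ω) hsimple.2 htr' hE hSc hSb
          h0S hav).2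
      · exact hav t ht (inter_subset_hpFill _ ⟨hS', Φ.mapsTo
          ⟨hsimple.2 t ht, Set.disjoint_left.1 hE (mem_range_self t)⟩⟩)
    rw [hL1, lintegral_congr_ae (indicator_ae_eq_of_ae_eq_set hR1)]
    exact thm65Tilted_proved κ hκ0 hκ A (hpFill S) hA hB Φ hΦ d hd

/-! ### L1: the tilted law identity -/

/-- **L1 — THE TILTED THEOREM 6.5 AT LAW LEVEL.** For `0 < κ ≤ 8/3`, a flat-window Dobrushin
domain `(D; a, b)`, the carved domain `D' = D ∖ B̄(x₀, r)` (`0 < r < ρ₀`, same marked points),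
`μ' = SLE_κ(D')`, the SLE_κ curve `Γ` of `D` through a chordal uniformizing map `φ`
(`μ = P ∘ Γ⁻¹`), the pulled-back hull `A = φ.pullbackHull D'` with restriction data `(Φ, d)`:
`∫_{E_A ∩ Γ⁻¹ T} X_A dP = d^α · μ'(T)` for every Borel `T`, where `E_A = {γ ∩ A = ∅}` and
`X_A = 𝒫(λ_κ ∫ m(A_t − W_t) dt)`, `α = sleBubbleExponent κ`. I.e. the finite measure
`(1_{E_A} X_A · P) ∘ Γ⁻¹` IS `d^α · SLE_κ(D')` — proof in the module docstring (transfer theorem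
on the chordal carrier of `D'` + `thm65Tilted_anchored` on the image test sets of `ψ = φ ∘ Φ_A⁻¹`).
[cite: LawlerSchrammWerner2003Restriction, Thm. 6.5 with Lemma 3.2 (p. 10) and Lemma 2.1 (p. 8)] -/
theorem stub_tiltedLawIdentity :
    ∀ (κ : ℝ≥0), 0 < κ → κ ≤ 8 / 3 →
      ∀ (D D' : DobrushinDomain) (μ μ' : Measure (CurveClass ℂ)) (x₀ : ℂ) (ρ₀ r : ℝ),
        0 < r → r < ρ₀ →
        D.carrier ∩ Metric.ball x₀ ρ₀ = {z : ℂ | x₀.im < z.im} ∩ Metric.ball x₀ ρ₀ →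
        ρ₀ ≤ dist x₀ (D.pt 0) → ρ₀ ≤ dist x₀ (D.pt 1) →
        D'.carrier = D.carrier \ Metric.closedBall x₀ r → D'.pt 0 = D.pt 0 → D'.pt 1 = D.pt 1 →
        IsSLELaw κ D μ → IsSLELaw κ D' μ' →
        ∀ (Γ : (ℝ≥0 → ℝ) → CurveClass ℂ) (φ : ConformalEquiv upperHalfPlaneSet D.carrier),
          D.IsChordalUniformizing φ → AEMeasurable Γ preWienerMeasure →
          (∀ᵐ ω ∂preWienerMeasure, Loewner.IsGeneratedByCurve (sleDriving κ ω) (sleTrace κ ω) ∧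
              ∃ c : Curve ℂ, Γ ω = CurveClass.mk c ∧
                IsCompactifiedImage φ.boundaryExtension (sleTrace κ ω) (D.pt 1) c) →
          μ = preWienerMeasure.map Γ →
          ∀ (Φ : ConformalEquiv (upperHalfPlaneSet \ φ.pullbackHull D') upperHalfPlaneSet),
            IsRestrictionMap (φ.pullbackHull D') Φ →
            ∀ (d : ℝ), HasRestrictionDeriv (φ.pullbackHull D') Φ d →
            ∀ T : Set (CurveClass ℂ), MeasurableSet T →
              ∫⁻ ω in {ω | Disjoint (range (sleTrace κ ω)) (φ.pullbackHull D')} ∩ Γ ⁻¹' T,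
                  poissonAvoidance (sleBubbleIntensity κ *
                    ∫⁻ t, ENNReal.ofReal (starBubbleMass
                      (Loewner.slidHull (sleDriving κ ω) (φ.pullbackHull D') t)) ∂timeMeasure)
                ∂preWienerMeasure =
              ENNReal.ofReal (d ^ sleBubbleExponent κ) * μ' T := by
  intro κ hκ0 hκ D D' μ μ' x₀ ρ₀ r _ hrρ _ ha hb hD' h0 h1 _ hμ' Γ φ hφ hΓm hΓae _ Φ hΦ d hd T hT
  classical
  haveI := isProbabilityMeasure_preWienerMeasure'
  -- classical inputs, all theorems of the tree
  have hsc : ∀ D : JordanDomain, D.isSimplyConnected := JordanDomain.isSimplyConnected_holds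
  have hRM : ∀ {U : Set ℂ}, exists_conformalEquiv_ball (U := U) := exists_conformalEquiv_ball_holds
  have hC : JordanDomain.exists_continuousOn_extension := JordanDomain.exists_continuousOn_extension_holds
  have hext : JordanDomain.continuousOn_boundaryExtension := JordanDomain.continuousOn_boundaryExtension_holds
  have h₈ : JordanDomain.mapsTo_boundaryExtension := JordanDomain.mapsTo_boundaryExtension_holds
  have h₉ : CurveClass.measurableSet_simple (E := ℂ) := CurveClass.measurableSet_simple_holds
  have hJarc : Literature.Topology.PlaneTopology.JordanArcSeparation :=
    Literature.Topology.PlaneTopology.JordanArcSeparation_holds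
  have hmeas : aemeasurable_sleTrace := aemeasurable_sleTrace_holds
  have hκ4 : κ ≤ 4 := le_four_of_le_eightThirds hκ
  have hκ8 : κ ≠ 8 := ne_eight_of_le_eightThirds hκ
  have hsub : D.IsHullSubdomain D' := isHullSubdomain_of_carved hrρ ha hb hD' h0 h1
  -- the SLE curve `Γ` of `D` through `φ` and the trace facts at `κ`
  have hΓc : IsSLECurve κ D Γ := IsSLECurve.of_through hφ hΓm hΓae
  have hgen : HasSLETrace κ := hΓc.hasSLETrace
  have htr := hΓc.ae_tendsto_norm_sleTrace_atTop
  have h₆ : ae_isSimpleTrace_sleTrace_of_le_four (κ := κ) :=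
    fun _ h4 ↦ ae_isSimpleTrace_sleTrace_of_hasSLETrace hgen h4
  have hΓsl : IsSLELaw κ D (preWienerMeasure.map Γ) := hΓc.isSLELaw_map
  -- the pulled-back hull and its restriction data
  have hA : IsStarHull (φ.pullbackHull D') := IsStarHull.pullbackHull hsc hφ hsub
  have hAc : IsClosed (φ.pullbackHull D') := hA.isBoundedHull.isClosed
  -- the uniformizing map `ψ = φ ∘ Φ⁻¹` of `D'` and the SLE law of `D'` through it
  set ψ : ConformalEquiv upperHalfPlaneSet D'.carrier :=
    Φ.symm.trans (φ.restrHull D' hsub.carrier_subset) with hψdef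
  have hψ : D'.IsChordalUniformizing ψ :=
    MarkedDomain.IsChordalUniformizing.pullback hsc hRM hC hφ hsub hΦ
  have hψsymm : ∀ w, ψ.symm w = Φ (φ.symm w) := fun w ↦ rfl
  obtain ⟨Γ', rfl, hΓ'm, hΓ'ae⟩ : ∃ Γ' : (ℝ≥0 → ℝ) → CurveClass ℂ,
      μ' = preWienerMeasure.map Γ' ∧ AEMeasurable Γ' preWienerMeasure ∧
      ∀ᵐ ω ∂preWienerMeasure, Loewner.IsGeneratedByCurve (sleDriving κ ω) (sleTrace κ ω) ∧
        ∃ c : Curve ℂ, Γ' ω = CurveClass.mk c ∧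
          IsCompactifiedImage ψ.boundaryExtension (sleTrace κ ω) (D'.pt 1) c := by
    obtain ⟨Γ', hΓ'm, hΓ'⟩ := exists_isSLECurve_through_of_ae_tendsto hgen htr hext (hmeas hgen) hψ
    obtain ⟨Γ₀, hΓ₀, rfl⟩ := hμ'
    exact ⟨Γ', IsSLECurve.map_eq_holds hΓ₀ (IsSLECurve.of_through hψ hΓ'm hΓ'), hΓ'm, hΓ'⟩
  have hΓ'sl : IsSLELaw κ D' (preWienerMeasure.map Γ') := (IsSLECurve.of_through hψ hΓ'm hΓ'ae).isSLELaw_map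
  haveI : IsProbabilityMeasure (preWienerMeasure.map Γ') := Measure.isProbabilityMeasure_map hΓ'm
  -- the good event
  have hgood : ∀ᵐ ω ∂preWienerMeasure,
      Loewner.IsSimpleTrace (sleTrace κ ω) ∧
      (∃ c : Curve ℂ, Γ ω = CurveClass.mk c ∧
        IsCompactifiedImage φ.boundaryExtension (sleTrace κ ω) (D.pt 1) c) ∧
      (∃ c' : Curve ℂ, Γ' ω = CurveClass.mk c' ∧
        IsCompactifiedImage ψ.boundaryExtension (sleTrace κ ω) (D'.pt 1) c') ∧
      (Γ ω ∈ CurveClass.simple ∧ (Γ ω).source = D.pt 0 ∧ (Γ ω).target = D.pt 1) := by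
    filter_upwards [hΓae, h₆ hκ0 hκ4, hΓ'ae, ae_of_ae_map hΓm (hΓsl.ae_simple h₆ h₉ hκ0 hκ4),
      ae_of_ae_map hΓm (hΓsl.ae_endpoints h₈)] with ω hω hs hω' h1' h2'
    exact ⟨hs, hω.2, hω'.2, h1'.1, h2'.1, h2'.2.1⟩
  -- notation: the avoidance event, the weight, a Borel version of the event
  set E : Set (ℝ≥0 → ℝ) := {ω | Disjoint (range (sleTrace κ ω)) (φ.pullbackHull D')} with hEdef
  set X : (ℝ≥0 → ℝ) → ℝ≥0∞ := fun ω ↦ poissonAvoidance (sleBubbleIntensity κ *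
    ∫⁻ t, ENNReal.ofReal (starBubbleMass (Loewner.slidHull (sleDriving κ ω) (φ.pullbackHull D') t))
      ∂timeMeasure) with hXdef
  have hEm : NullMeasurableSet E preWienerMeasure := nullMeasurableSet_setOf_disjoint hκ8 hAc
  obtain ⟨E₀, hE₀sub, hE₀m, hE₀eq⟩ := hEm.exists_measurable_subset_ae_eq
  -- the tilted measure `ρ = 1_{E_A} X_A · P` and its image `ν₁ = ρ ∘ Γ⁻¹`
  set ρ : Measure (ℝ≥0 → ℝ) := preWienerMeasure.withDensity (E₀.indicator X) with hρdef
  haveI hρfin : IsFiniteMeasure ρ := by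
    refine isFiniteMeasure_withDensity (ne_top_of_le_ne_top ENNReal.one_ne_top ?_)
    calc ∫⁻ ω, E₀.indicator X ω ∂preWienerMeasure ≤ ∫⁻ _, 1 ∂preWienerMeasure :=
          lintegral_mono fun ω ↦ Set.indicator_apply_le' (fun _ ↦ poissonAvoidance_le_one _)
            (fun _ ↦ bot_le)
      _ = 1 := by rw [lintegral_one, measure_univ]
  have hρP : ρ ≪ preWienerMeasure := withDensity_absolutelyContinuous _ _
  have hΓρ : AEMeasurable Γ ρ := hΓm.mono_ac hρP
  set ν₁ : Measure (CurveClass ℂ) := ρ.map Γ with hν₁def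
  have hν₁ : ∀ S : Set (CurveClass ℂ), MeasurableSet S →
      ν₁ S = ∫⁻ ω, (Γ ⁻¹' S ∩ E₀).indicator X ω ∂preWienerMeasure := by
    intro S hS
    rw [hν₁def, Measure.map_apply_of_aemeasurable hΓρ hS, hρdef, withDensity_apply' _ (Γ ⁻¹' S),
      ← lintegral_indicator₀ (hΓm.nullMeasurableSet_preimage hS) (E₀.indicator X),
      Set.indicator_indicator]
  -- on the good event, on `E_A` the image curve is a chordal simple curve of `D'`
  set R : Set (CurveClass ℂ) := chordalCarrier D' with hRdef
  have hRm : MeasurableSet R := measurableSet_chordalCarrier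
  have hER : ∀ᵐ ω ∂preWienerMeasure, ω ∈ E₀ → Γ ω ∈ R := by
    filter_upwards [hgood, hE₀eq.mem_iff] with ω ⟨hsimple, ⟨c, hΓω, hc⟩, _, hΓs, hΓsrc, hΓtgt⟩ hE₀E hω0
    have hE : Disjoint (range (sleTrace κ ω)) (φ.pullbackHull D') := hE₀E.1 hω0
    have hr := (disjoint_range_pullbackHull_iff hφ hsub (sleTrace_zero _ ω) hsimple.2 hc).1 hE
    rw [hΓω] at hΓs hΓsrc hΓtgt ⊢
    exact ⟨⟨⟨hΓs, hΓsrc.trans hsub.pt_zero_eq.symm⟩, hΓtgt.trans hsub.pt_one_eq.symm⟩, hr⟩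
  -- the identity of finite measures `ν₁ = d^α • μ'`: transfer through the avoidance code
  set m : ℝ≥0 := (d ^ sleBubbleExponent κ).toNNReal with hmdef
  have hmcoe : (m : ℝ≥0∞) = ENNReal.ofReal (d ^ sleBubbleExponent κ) := rfl
  have hident : ν₁ = m • preWienerMeasure.map Γ' := by
    refine CurveClass.Measure.ext_of_missCode_injOn (C := imageTest ψ)
      (fun n ↦ isClosed_imageTest hC n) hRm (injOn_missCode_imageTest hJarc hC hψ) ?_ ?_ ?_
    · -- `ν₁` is carried by the chordal carrier of `D'`
      rw [ae_iff]
      change ν₁ Rᶜ = 0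
      rw [hν₁ _ hRm.compl]
      have hz : (fun ω ↦ (Γ ⁻¹' Rᶜ ∩ E₀).indicator X ω) =ᵐ[preWienerMeasure] fun _ ↦ 0 := by
        filter_upwards [hER] with ω hω
        refine indicator_of_notMem (fun h ↦ ?_) _
        exact h.1 (hω h.2)
      rw [lintegral_congr_ae hz, lintegral_zero]
    · -- so is `μ'`
      refine Measure.ae_smul_measure ?_ _
      filter_upwards [hΓ'sl.ae_simple h₆ h₉ hκ0 hκ4, hΓ'sl.ae_endpoints h₈] with x h1' h2'
      exact ⟨⟨⟨h1'.1, h2'.1⟩, h2'.2.1⟩, subset_carrier_union_of_inter_frontier h2'.2.2 h1'.2⟩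
    · intro s
      obtain ⟨hS0, hSc, hSsub, h0S⟩ := biUnion_anchoredSeq s
      have havm : MeasurableSet (CurveClass.rangeSubset
          (ψ.boundaryExtension '' ⋃ n ∈ s, anchoredSeq n)ᶜ : Set (CurveClass ℂ)) :=
        CurveClass.measurableSet_rangeSubset_compl
          (MarkedDomain.isCompact_image_boundaryExtension hC hSsub hSc).isClosed
      rw [biUnion_imageTest, Measure.coe_nnreal_smul_apply, hmcoe, hν₁ _ havm,
        Measure.map_apply_of_aemeasurable hΓ'm havm]
      -- `μ' {Γ' ∩ ψ(S) = ∅} = P[γ ∩ S = ∅]`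
      have hL : preWienerMeasure (Γ' ⁻¹' CurveClass.rangeSubset
          (ψ.boundaryExtension '' ⋃ n ∈ s, anchoredSeq n)ᶜ) =
          preWienerMeasure {ω | Disjoint (range (sleTrace κ ω)) (⋃ n ∈ s, anchoredSeq n)} := by
        refine measure_congr (eventuallyEq_set.2 ?_)
        filter_upwards [hgood] with ω ⟨hsimple, _, ⟨c', hΓ'ω, hc'⟩, _⟩
        rw [mem_preimage, hΓ'ω]
        exact hc'.mk_mem_rangeSubset_compl_image_iff hψ (sleTrace_zero _ ω) hsimple.2 hC hSsub h0S
      -- `{Γ ∩ ψ(S) = ∅} ∩ E_A = {γ ∩ A = ∅, Φ_A(γ(0,∞)) ∩ S = ∅}` a.s.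
      have hRt : (Γ ⁻¹' CurveClass.rangeSubset (ψ.boundaryExtension '' ⋃ n ∈ s, anchoredSeq n)ᶜ ∩ E₀ :
          Set (ℝ≥0 → ℝ)) =ᵐ[preWienerMeasure]
          ({ω | Disjoint (range (sleTrace κ ω)) (φ.pullbackHull D') ∧
            ∀ t, 0 < t → Φ (sleTrace κ ω t) ∉ ⋃ n ∈ s, anchoredSeq n} : Set (ℝ≥0 → ℝ)) := by
        refine eventuallyEq_set.2 ?_
        filter_upwards [hgood, hE₀eq.mem_iff] with ω ⟨hsimple, ⟨c, hΓω, hc⟩, _⟩ hE₀E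
        constructor
        · rintro ⟨hav, hω0⟩
          have hE : Disjoint (range (sleTrace κ ω)) (φ.pullbackHull D') := hE₀E.1 hω0
          refine ⟨hE, ?_⟩
          rw [mem_preimage, hΓω] at hav
          exact (mk_mem_rangeSubset_compl_image_iff_of_disjoint hC hφ hsub hψ hψsymm
            (sleTrace_zero _ ω) hsimple.2 hc hE hSsub h0S).1 hav
        · rintro ⟨hE, hav⟩
          refine ⟨?_, hE₀E.2 hE⟩
          rw [mem_preimage, hΓω]
          exact (mk_mem_rangeSubset_compl_image_iff_of_disjoint hC hφ hsub hψ hψsymm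
            (sleTrace_zero _ ω) hsimple.2 hc hE hSsub h0S).2 hav
      rw [hL, lintegral_congr_ae (indicator_ae_eq_of_ae_eq_set hRt)]
      rcases hS0 with hS0 | hSanch
      · exact thm65Tilted_anchored hκ0 hκ hA hΦ hd htr hSc.isClosed hSc.isBounded h0S (Or.inl hS0)
      · exact thm65Tilted_anchored hκ0 hκ hA hΦ hd htr hSc.isClosed hSc.isBounded h0S (Or.inr hSanch.2)
  -- evaluate the identity of measures at `T`
  have hTeq : ν₁ T = (m • preWienerMeasure.map Γ') T := by rw [hident]
  rw [Measure.coe_nnreal_smul_apply, hmcoe, hν₁ T hT,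
    lintegral_indicator₀ ((hΓm.nullMeasurableSet_preimage hT).inter hE₀m.nullMeasurableSet)] at hTeq
  rw [← hTeq, inter_comm (Γ ⁻¹' T) E₀]
  exact (setLIntegral_congr (hE₀eq.inter (ae_eq_refl (Γ ⁻¹' T)))).symm

end Summit.CriticalPhenomena.SAWScalingLimit.Theorems.SubseqIdentification.BoundaryAreaLaw

end
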